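import Literature.NumberTheory.LFunctions.Zhang2022.DetectorRecipeCollapse

/-!
# Zhang (2022), programme F-S3 (cell landau-siegel, §E E-102 HEAD 2 = `Det.MonomialConePSD`): the BULK SYMBOL
# `p_b(ξ) = ξ(ξ+b₀)(ξ+b₁)(ξ+b₂)` of the recipe form, its sign on the integers (= sign-admissibility), the real and
# imaginary parts of the collapsed form `Q_b(g,g)`, and the reduction of `𝔅_{R(b)} ⪰ 0` on the clamped subspace to
# ONE displayed analytic input (bulk non-negativity, the Parseval lemma of the cell's memo PARSEVAL-C2)

Y. Zhang, *Discrete mean estimates and the Landau–Siegel zero*, arXiv:2211.02515v1 [Zhang2022LandauSiegel] —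
an unrefereed manuscript under adjudication. **WHAT THIS IS NOT: not a claim about Theorems 1–2 of
arXiv:2211.02515, about Landau–Siegel zeros, or about Parity; nothing here asserts any claim of the manuscript.**
«The programme SEARCHES and TYPES; no claim about Landau–Siegel zeros, Theorems 1–2 of arXiv:2211.02515 or a
repaired Margin232 until a kernel theorem says so.»

Context (cell documents, not literature): barrier/num/SHIFT-PSD.md (sha16 c125d6d322cd98b2, ls-barrier-num) derived the
closed form of the recipe form of a shift triple in terms of the tail primitive `S = ∫_y^1 g` — `(π/2)·𝔅_{R(b)}(g) =
c₀·T_b(S) + x₀*·Bdm(b)·x₀`, `c₀ = Re m₀(b)`, bulk form `T_b(S) = ‖S″‖² + πe₁Im⟨S″,S′⟩ + π²e₂‖S′‖² + π³e₃Im⟨S′,S⟩` with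
frequency symbol `π⁴·p_b`, `p_b(η) = η(η+b₀)(η+b₁)(η+b₂)`, negative exactly on the two bands `(−b₀,0)`, `(−b₂,−b₁)` — and
the exact criterion `(C1) c₀ > 0 ∧ (C2) T_b ⪰ 0 on the clamped space V₀₀ ∧ (C3) a 2×2 matrix ⪰ 0`. The cell's memo
PARSEVAL-C2 (ls-Bdet-typer-2, 62a6312065d4c6d0) observes that Parseval on `[0,1] ⊂ [0,2]` gives
`T_b(S) = (π⁴/2)Σ_{ξ∈ℤ} p_b(ξ)|Ŝ(ξ)|²` on V₀₀, so `(C2)` holds for every sign-admissible `b` because `p_b ≥ 0` ON THE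
INTEGERS is exactly the lattice-symbol form of sign-admissibility. This file types the ALGEBRAIC half of that route,
kernel-checked, in the tree's `g`-vocabulary (`Det.shiftCore` of `DetectorRecipeCollapse`, `Re Q_b(g,g) = T_b(S)`):

* Part 1 — `Det.bulkSymbol b x = x(x+b₀)(x+b₁)(x+b₂)`; **`bulkSymbol_intCast_nonneg_iff`**: for positive shifts,
  `(∀ k : ℤ, 0 ≤ p_b(k)) ↔ Det.LatticeSymbolNonpos b`; hence `0 ≤ p_b(k)` for every integer `k` under `SignAdmissible b`
  (`SignAdmissible.bulkSymbol_intCast_nonneg`), and STRICT positivity at every non-zero integer when no shift is an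
  integer (`bulkSymbol_intCast_pos_of_offLattice`).
* Part 2 — the real and imaginary parts of the collapsed diagonal form for a one-sided kinked profile:
  `Re Q_b(g,g) = Re⟨g′,g′⟩ − πe₁Im⟨g,g′⟩ + π²e₂Re⟨g,g⟩ − π³e₃Im(|∫g|² − ⟨g,S_g⟩)` (= `T_b(S)`, any profile) and
  **`Im Q_b(g,g) = −(πe₁/2)|g(0)|² + (π³e₃/2)|∫g|²`** (boundary data only: `2Re⟨g,g′⟩ = −|g(0)|²`,
  `2Re⟨g,S_g⟩ = |∫g|²`) — SHIFT-PSD's bookkeeping as a theorem; so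
  `𝔅^{dd}_b(g) = (2/π)(Re m₀·Re Q_b − Im m₀·Im Q_b) − 2Im(m_s)|g(0)|² − 2πRe(m_n·g(0)·conj∫g)` (`formDetDD_eq_reIm`).
* Part 3 — the CLAMPED subspace `g(0) = 0 ∧ ∫₀¹g = 0` (SHIFT-PSD's `V₀₀` in profile language): there
  `𝔅^{dd}_b(g) = (2/π)·Re m₀(b)·Re Q_b(g,g)` (`formDetDD_eq_of_clamped`); the displayed analytic input
  **`Det.BulkNonneg b`** («`Re Q_b(g,g) ≥ 0` for every clamped one-sided kinked `g`» — the conclusion of the Parseval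
  lemma, NOT proved here; a `Prop` with the triple as parameter, never asserted) and the one-line consequence
  `formDetDD_nonneg_of_clamped : BulkNonneg b → 0 ≤ Re m₀(b) → (clamped g) → 0 ≤ 𝔅^{dd}_b(g)`.

NOT here: the Parseval lemma itself (`BulkNonneg b` for sign-admissible `b`; Mathlib `fourierBasis` on `AddCircle 2`,
planned leaf), the `(C3)` reduction on the 2-dimensional complement (SHIFT-PSD §0.3; barrier-num's statement shapes
`Det.afeGram`, `Det.ShadowControlsKernel`), and any positivity claim about a specific triple. 0 named facts (every `Prop`
has explicit parameters), 0 sorries.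

## References

* Y. Zhang, arXiv:2211.02515v1 (2022), §2 Lemma 2.3 (2.13); Prop 7.1 p.44; §8 (8.11)–(8.23). [cite: Zhang2022LandauSiegel, §2 Lemma 2.3; Prop 7.1 p.44]
* Cell documents (not literature): barrier/num/SHIFT-PSD.md c125d6d322cd98b2 §0–§2; barrier/num/H-CLOSED-FORM.md
  f80d823e4b71f884; ls-Bdet-typer-2/parseval/PARSEVAL-C2.md 62a6312065d4c6d0; B-det/plan/E102-DISCHARGE.md v1.4 §4b.
-/

noncomputable section

open Complex Real ComplexConjugate Set MeasureTheory intervalIntegral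

namespace Literature.NumberTheory.LFunctions.Zhang2022

namespace Det

open Repair

variable {b : Fin 3 → ℝ} {g g' : ℝ → ℂ}

/-! ### Part 1 — the bulk symbol and its sign on the integers -/

/-- **The bulk symbol `p_b(x) = x·(x+b₀)(x+b₁)(x+b₂)`** of the recipe form of the triple `b` (frequency variable `x`;
SHIFT-PSD §0.2: the symbol of `T_b` is `π⁴p_b`). [cite: Zhang2022LandauSiegel, Prop 7.1 p.44 with (8.11)–(8.23)] -/
def bulkSymbol (b : Fin 3 → ℝ) (x : ℝ) : ℝ := x * ((x + b 0) * (x + b 1) * (x + b 2))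

/-- Unfolding `bulkSymbol`. [cite: Zhang2022LandauSiegel, Prop 7.1 p.44 with (8.11)–(8.23)] -/
theorem bulkSymbol_def (b : Fin 3 → ℝ) (x : ℝ) : bulkSymbol b x = x * ((x + b 0) * (x + b 1) * (x + b 2)) := rfl

/-- `p_b(0) = 0`. [cite: Zhang2022LandauSiegel, Prop 7.1 p.44] -/
theorem bulkSymbol_zero (b : Fin 3 → ℝ) : bulkSymbol b 0 = 0 := by simp [bulkSymbol]

/-- At a negative integer `x = −k`: `p_b(−k) = k·((b₀−k)(b₁−k)(b₂−k))·(−1)… = −k·Π(b_j − k)·(−1)^0`; precisely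
`p_b(−k) = -k * ((b₀-k)(b₁-k)(b₂-k))`. [cite: Zhang2022LandauSiegel, §2 Lemma 2.3 (2.13)] -/
theorem bulkSymbol_neg (b : Fin 3 → ℝ) (k : ℝ) :
    bulkSymbol b (-k) = -(k * ((b 0 - k) * (b 1 - k) * (b 2 - k))) := by
  unfold bulkSymbol; ring

/-- `p_b(x) > 0` for `x > 0` when the shifts are positive. [cite: Zhang2022LandauSiegel, §2 Lemma 2.3 (2.13)] -/
theorem bulkSymbol_pos_of_pos (hb : ∀ j, 0 < b j) {x : ℝ} (hx : 0 < x) : 0 < bulkSymbol b x := by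
  unfold bulkSymbol
  have h0 := hb 0; have h1 := hb 1; have h2 := hb 2
  positivity

/-- **Sign of the bulk symbol on the integers = the lattice-symbol test**: for positive shifts,
`(∀ k : ℤ, 0 ≤ p_b(k)) ↔ LatticeSymbolNonpos b` (`Π_j(b_j − k) ≤ 0` for every integer `k ≥ 1`).
[cite: Zhang2022LandauSiegel, §2 Lemma 2.3 (2.13)] -/
theorem bulkSymbol_intCast_nonneg_iff (hb : ∀ j, 0 < b j) :
    (∀ k : ℤ, 0 ≤ bulkSymbol b (k : ℝ)) ↔ LatticeSymbolNonpos b := by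
  constructor
  · intro h k hk
    have hk' := h (-(k : ℤ))
    push_cast at hk'
    rw [bulkSymbol_neg] at hk'
    have hkpos : (0 : ℝ) < k := by exact_mod_cast hk
    by_contra hneg
    push Not at hneg
    have : 0 < (k : ℝ) * ((b 0 - k) * (b 1 - k) * (b 2 - k)) := mul_pos hkpos hneg
    linarith
  · intro h k
    rcases lt_trichotomy k 0 with hk | hk | hk
    · -- k = -n, n ≥ 1
      obtain ⟨n, hn⟩ : ∃ n : ℕ, (k : ℤ) = -(n : ℤ) := ⟨k.natAbs, by omega⟩
      have hn1 : 1 ≤ n := by omega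
      have hcast : ((k : ℤ) : ℝ) = -((n : ℕ) : ℝ) := by rw [hn]; push_cast; ring
      rw [hcast, bulkSymbol_neg]
      have hle := h n hn1
      have hnpos : (0 : ℝ) ≤ n := by positivity
      nlinarith [mul_nonpos_of_nonneg_of_nonpos hnpos hle]
    · subst hk; simp [bulkSymbol]
    · exact (bulkSymbol_pos_of_pos hb (by exact_mod_cast hk)).le

/-- **For a sign-admissible triple the bulk symbol is `≥ 0` at every integer** (no integer lies strictly inside the
negative bands `(−b₀,0)`, `(−b₂,−b₁)`). [cite: Zhang2022LandauSiegel, §2 Lemma 2.3 (2.13)] -/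
theorem SignAdmissible.bulkSymbol_intCast_nonneg (h : SignAdmissible b) (k : ℤ) : 0 ≤ bulkSymbol b (k : ℝ) :=
  (bulkSymbol_intCast_nonneg_iff h.pos).2 h.latticeSymbolNonpos k

/-- **Strictness off the lattice**: if moreover no shift is an integer, `p_b(k) > 0` at every NON-ZERO integer `k`.
[cite: Zhang2022LandauSiegel, §2 Lemma 2.3 (2.13)] -/
theorem bulkSymbol_intCast_pos_of_offLattice (h : SignAdmissible b) (hoff : ∀ (j : Fin 3) (n : ℤ), b j ≠ n)
    {k : ℤ} (hk : k ≠ 0) : 0 < bulkSymbol b (k : ℝ) := by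
  rcases (h.bulkSymbol_intCast_nonneg k).lt_or_eq with hlt | heq
  · exact hlt
  · exfalso
    -- `p_b(k) = 0` with `k ≠ 0` forces `k + b_j = 0` for some `j`, i.e. `b_j = -k ∈ ℤ`
    have hk' : (k : ℝ) ≠ 0 := by exact_mod_cast hk
    have hprod : ((k : ℝ) + b 0) * ((k : ℝ) + b 1) * ((k : ℝ) + b 2) = 0 := by
      have := heq.symm
      unfold bulkSymbol at this
      rcases mul_eq_zero.1 this with h0 | h1
      · exact absurd h0 hk'
      · exact h1
    rcases mul_eq_zero.1 hprod with h01 | h2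
    · rcases mul_eq_zero.1 h01 with h0 | h1
      · exact hoff 0 (-k) (by push_cast; linarith)
      · exact hoff 1 (-k) (by push_cast; linarith)
    · exact hoff 2 (-k) (by push_cast; linarith)

/-! ### Part 2 — real and imaginary parts of the collapsed diagonal form `Q_b(g,g)` -/

/-- **`Re Q_e(g,g) = Re⟨g′,g′⟩ − πe₁·Im⟨g,g′⟩ + π²e₂·Re⟨g,g⟩ − π³e₃·Im(∫g·conj∫g − ⟨g,S_g⟩)`** (any profile; this is
SHIFT-PSD's bulk form `T_b(S)` of the tail primitive `S = ∫_y^1 g`, since `S′ = −g`, `S″ = −g′`, `⟨g,P_g⟩ = |∫g|² − ⟨g,S_g⟩`).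
[cite: Zhang2022LandauSiegel, Prop 7.1 p.44 with (8.11)–(8.23)] -/
theorem re_shiftCore_self (e1 e2 e3 : ℝ) (g g' : ℝ → ℂ) :
    (shiftCore e1 e2 e3 g g' g g').re
      = (∫ x in (0:ℝ)..1, g' x * conj (g' x)).re
        - π * e1 * (∫ x in (0:ℝ)..1, g x * conj (g' x)).im
        + π ^ 2 * e2 * (∫ x in (0:ℝ)..1, g x * conj (g x)).re
        - π ^ 3 * e3 * ((∫ x in (0:ℝ)..1, g x) * conj (∫ x in (0:ℝ)..1, g x)
            - ∫ x in (0:ℝ)..1, g x * conj (∫ t in (0:ℝ)..x, g t)).im := by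
  unfold shiftCore
  simp only [Complex.add_re, Complex.mul_re, Complex.mul_im, Complex.I_re, Complex.I_im, Complex.ofReal_re,
    Complex.ofReal_im, Complex.sub_re, Complex.sub_im]
  simp only [← Complex.ofReal_pow, Complex.ofReal_re, Complex.ofReal_im]
  ring

/-- **`Im Q_e(g,g) = πe₁·Re⟨g,g′⟩ + π³e₃·Re(∫g·conj∫g − ⟨g,S_g⟩)`** (any profile). [cite: Zhang2022LandauSiegel, Prop 7.1 p.44 with (8.11)–(8.23)] -/
theorem im_shiftCore_self (e1 e2 e3 : ℝ) (g g' : ℝ → ℂ) :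
    (shiftCore e1 e2 e3 g g' g g').im
      = (∫ x in (0:ℝ)..1, g' x * conj (g' x)).im
        + π * e1 * (∫ x in (0:ℝ)..1, g x * conj (g' x)).re
        + π ^ 2 * e2 * (∫ x in (0:ℝ)..1, g x * conj (g x)).im
        + π ^ 3 * e3 * ((∫ x in (0:ℝ)..1, g x) * conj (∫ x in (0:ℝ)..1, g x)
            - ∫ x in (0:ℝ)..1, g x * conj (∫ t in (0:ℝ)..x, g t)).re := by
  unfold shiftCore
  simp only [Complex.add_im, Complex.mul_re, Complex.mul_im, Complex.I_re, Complex.I_im, Complex.ofReal_re,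
    Complex.ofReal_im, Complex.sub_re, Complex.sub_im]
  simp only [← Complex.ofReal_pow, Complex.ofReal_re, Complex.ofReal_im]
  ring

/-- `⟨u,u⟩ = ∫₀¹ u·conj u` is real: its imaginary part vanishes. [folklore] -/
private theorem im_integral_mul_conj_self (u : ℝ → ℂ) : (∫ x in (0:ℝ)..1, u x * conj (u x)).im = 0 := by
  have h : (fun x => u x * conj (u x)) = fun x => ((‖u x‖ ^ 2 : ℝ) : ℂ) := by
    funext x; rw [Complex.mul_conj', Complex.ofReal_pow]
  rw [h, intervalIntegral.integral_ofReal, Complex.ofReal_im]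

/-- **The imaginary part of `Q_b(g,g)` is boundary data**: for a one-sided kinked profile,
`Im Q_e(g,g) = −(πe₁/2)|g(0)|² + (π³e₃/2)|∫₀¹g|²` (`2Re⟨g,g′⟩ = −|g(0)|²`, `2Re⟨g,S_g⟩ = |∫g|²`; SHIFT-PSD §1).
[cite: Zhang2022LandauSiegel, Prop 7.1 p.44 with (7.2), (8.11)–(8.23)] -/
theorem im_shiftCore_self_oneSided (e1 e2 e3 : ℝ) (hg : KinkedProfile g g') (hg1 : g 1 = 0) :
    (shiftCore e1 e2 e3 g g' g g').im
      = -(π * e1 / 2) * ‖g 0‖ ^ 2 + π ^ 3 * e3 / 2 * ‖∫ x in (0:ℝ)..1, g x‖ ^ 2 := by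
  rw [im_shiftCore_self, im_integral_mul_conj_self, im_integral_mul_conj_self]
  -- `2Re⟨g,g′⟩ = −|g(0)|²`
  have hparts := integral_deriv_mul_conj_add hg hg
  rw [hg1, zero_mul, zero_sub] at hparts
  have h1 : (∫ x in (0:ℝ)..1, g x * conj (g' x)).re = -(‖g 0‖ ^ 2) / 2 := by
    have hre := congrArg Complex.re hparts
    rw [Complex.add_re, Complex.neg_re, Complex.mul_conj', ← Complex.ofReal_pow, Complex.ofReal_re] at hre
    -- `Re⟨g′,g⟩ = Re⟨g,g′⟩` (conjugates)
    have hswap : (∫ x in (0:ℝ)..1, g' x * conj (g x)).re = (∫ x in (0:ℝ)..1, g x * conj (g' x)).re := by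
      have : (∫ x in (0:ℝ)..1, g' x * conj (g x)) = conj (∫ x in (0:ℝ)..1, g x * conj (g' x)) := by
        rw [← intervalIntegral_conj]; congr 1; funext x; simp [mul_comm]
      rw [this, Complex.conj_re]
    linarith
  -- `2Re⟨g,S_g⟩ = |∫g|²`
  have h2 := two_mul_re_integral_mul_conj_primitive hg.cont
  have h3 : ((∫ x in (0:ℝ)..1, g x) * conj (∫ x in (0:ℝ)..1, g x)).re = ‖∫ x in (0:ℝ)..1, g x‖ ^ 2 := by
    rw [Complex.mul_conj', ← Complex.ofReal_pow, Complex.ofReal_re]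
  have h2' : (∫ x in (0:ℝ)..1, g x * conj (∫ t in (0:ℝ)..x, g t)).re = ‖∫ x in (0:ℝ)..1, g x‖ ^ 2 / 2 := by
    linarith
  rw [Complex.sub_re, h3, h1, h2']
  ring

/-- **The diagonal recipe form in real data** (SHIFT-PSD §0.2 as a theorem, tree vocabulary): for a one-sided kinked `g`,
`𝔅^{dd}_b(g) = (2/π)(Re m₀·Re Q_b(g,g) − Im m₀·(−(πe₁/2)|g(0)|² + (π³e₃/2)|∫g|²)) − 2Im(m_s)|g(0)|² − 2πRe(m_n·g(0)·conj∫g)`.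
[cite: Zhang2022LandauSiegel, Prop 7.1 p.44 with (8.11)–(8.23)] -/
theorem formDetDD_eq_reIm (b : Fin 3 → ℝ) (hg : KinkedProfile g g') (hg1 : g 1 = 0) :
    FormDetDD b g g'
      = 2 / π * ((ddM0 b).re * (shiftCore (symE1 b) (symE2 b) (symE3 b) g g' g g').re
          - (ddM0 b).im * (-(π * symE1 b / 2) * ‖g 0‖ ^ 2 + π ^ 3 * symE3 b / 2 * ‖∫ x in (0:ℝ)..1, g x‖ ^ 2))
        - 2 * (ddMs b).im * ‖g 0‖ ^ 2
        - 2 * π * (ddMn b * (g 0 * conj (∫ x in (0:ℝ)..1, g x))).re := by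
  rw [formDetDD_eq_collapse b hg hg1, Complex.mul_re, im_shiftCore_self_oneSided _ _ _ hg hg1]

/-! ### Part 3 — the clamped subspace `g(0) = 0`, `∫g = 0` and the displayed bulk input -/

/-- On the CLAMPED one-sided class (`g(1) = 0`, `g(0) = 0`, `∫₀¹ g = 0`; SHIFT-PSD's `V₀₀` for `S = ∫_y^1 g`) the recipe form
is the bulk alone: `𝔅^{dd}_b(g) = (2/π)·Re m₀(b)·Re Q_b(g,g)`. [cite: Zhang2022LandauSiegel, Prop 7.1 p.44 with (8.11)–(8.23)] -/
theorem formDetDD_eq_of_clamped (b : Fin 3 → ℝ) (hg : KinkedProfile g g') (hg1 : g 1 = 0) (hg0 : g 0 = 0)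
    (hI : (∫ x in (0:ℝ)..1, g x) = 0) :
    FormDetDD b g g' = 2 / π * ((ddM0 b).re * (shiftCore (symE1 b) (symE2 b) (symE3 b) g g' g g').re) := by
  rw [formDetDD_eq_reIm b hg hg1, hg0, hI]
  simp

/-- **The displayed analytic input `(C2)`: bulk non-negativity on the clamped class** — «`Re Q_b(g,g) ≥ 0` for every
one-sided kinked `g` with `g(0) = 0` and `∫₀¹g = 0`». By the cell's Parseval memo this holds for every sign-admissible `b`
(`Re Q_b(g,g) = (π²/2)Σ_{ξ≠0} [(ξ+b₀)(ξ+b₁)(ξ+b₂)/ξ]·|ĝ(ξ)|²` with non-negative weights); that lemma is NOT in this file —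
here the statement is a `Prop` with the triple as parameter, used as a hypothesis. [cite: Zhang2022LandauSiegel, Prop 7.1 p.44; §2 Lemma 2.3] -/
def BulkNonneg (b : Fin 3 → ℝ) : Prop :=
  ∀ g g' : ℝ → ℂ, KinkedProfile g g' → g 1 = 0 → g 0 = 0 → (∫ x in (0:ℝ)..1, g x) = 0 →
    0 ≤ (shiftCore (symE1 b) (symE2 b) (symE3 b) g g' g g').re

/-- **Consequence on the clamped class**: bulk non-negativity and `Re m₀(b) ≥ 0` (SHIFT-PSD (C1); H-CLOSED-FORM (I1) for
admissible `b`) give `𝔅^{dd}_b(g) ≥ 0` for every clamped one-sided kinked profile. The 2-dimensional complement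
(`g(0)`, `∫g`) is SHIFT-PSD's (C3), not treated here. [cite: Zhang2022LandauSiegel, Prop 7.1 p.44 with (8.11)–(8.23)] -/
theorem formDetDD_nonneg_of_clamped (hC2 : BulkNonneg b) (hc0 : 0 ≤ (ddM0 b).re) (hg : KinkedProfile g g')
    (hg1 : g 1 = 0) (hg0 : g 0 = 0) (hI : (∫ x in (0:ℝ)..1, g x) = 0) : 0 ≤ FormDetDD b g g' := by
  rw [formDetDD_eq_of_clamped b hg hg1 hg0 hI]
  have hQ := hC2 g g' hg hg1 hg0 hI
  have hπ : 0 < 2 / π := by positivity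
  exact mul_nonneg hπ.le (mul_nonneg hc0 hQ)

/-- … and for a DISTINCT triple the recipe form `𝔅_{R(b)}` itself on the clamped class. [cite: Zhang2022LandauSiegel, Prop 7.1 p.44 with (8.11)–(8.23)] -/
theorem formDet_shiftRecipe_nonneg_of_clamped (hb : Function.Injective b) (hC2 : BulkNonneg b)
    (hc0 : 0 ≤ (ddM0 b).re) (hg : KinkedProfile g g') (hg1 : g 1 = 0) (hg0 : g 0 = 0)
    (hI : (∫ x in (0:ℝ)..1, g x) = 0) : 0 ≤ FormDet (shiftRecipe b) g g' := by
  rw [← formDetDD_eq_formDet hb hg hg1]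
  exact formDetDD_nonneg_of_clamped hC2 hc0 hg hg1 hg0 hI

end Det

end Literature.NumberTheory.LFunctions.Zhang2022
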